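import Mathlib
import Literature.MathematicalPhysics.QuantumFieldTheory.Balaban1983to89.B5QGQInverseL2Zd
import Literature.MathematicalPhysics.QuantumFieldTheory.Balaban1983to89.B5HkUniformL2Zd

/-!
# [B6] (2.72)–(2.73), (2.78) p. 236 and (2.79) p. 237 — the SQUARE `Q'G'²Q'*` on the whole lattice `ℤ^d`, scalar case:
# mesh-free two-sided bounds, kernel decay, and the Sect.-5 inverse `C = (Q'G'²Q'*)⁻¹`

[B6] = T. Bałaban, *Propagators and renormalization transformations for lattice gauge theories. II*, Commun. Math.
Phys. **96** (1984) 223–250 [`Balaban1984PropagatorsII`]; [B9] = T. Bałaban, *Propagators for lattice gauge theories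
in a background field*, Commun. Math. Phys. **99** (1985) 389–434 [`Balaban1985BackgroundPropagators`]; [B4] =
T. Bałaban, *Regularity and decay of lattice Green's functions*, Commun. Math. Phys. **89** (1983) 571–597
[`Balaban1983RegularityDecay`].  PRINTED TEXT (TEXT LOCATIONS ONLY — nothing printed enters as a hypothesis; the
quotations were checked against the page renders `…1984-cmp96-propagators-rt-II-p014-x2.png` (p. 236),
`…-p015-x2.png` (p. 237) and `…1985-cmp99-background-propagators-p007-x2.png` ([B9] p. 395) READ AS IMAGES by this
seat):

* [B6] p. 236: «⟨ω₁, Q′_jG′^ξ(□̃)²Q′_j*ω₁⟩ = ‖G′^ξ(□̃)Q′_j*ω₁‖².  (2.72)  By Bessel's inequality the squared norm can be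
  estimated from below by a sum of squares of coefficients in a decomposition of a vector with respect to an arbitrary
  orthonormal system. As the orthonormal system we take characteristic functions of unit blocks Δ = B^j(y) ⊂ □̃.»; the
  chain (2.73) ends in «= |⟨ω₁, Q′_jG′^ξ(□̃)Q′_j*ω₁⟩|² (1/‖ω₁‖²)»; «Q′_jG′_jQ′_j* ≥ 2γ₀;  (2.76)  γ₀ is a positive,
  absolute constant (a = 1).»; «The inequalities (2.73) and (2.77) together with the equalities (2.71) and (2.72) imply
  ⟨ω, Q′G′^ξ(□̃)²Q′*ω⟩ ≥ γ₀²‖ω₁‖² = γ₀²‖Q″*ω‖² ≥ γ₀²‖ω‖².  (2.78)».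
* [B6] p. 237: «Of course we have also a bound from above and an exponential decay of the kernel of Q′G′^ξ(□̃)²Q′*
  with the decay rate δ₀. Hence the operator C^ξ_□ is bounded from above and below by absolute constants. We can use
  the theory developed in Sect. 5 [3] to conclude that it has an exponential decay with a decay rate δ₁ depending on δ₀
  and the bound γ₀.» … «Thus we have |C^ξ_□(y, y′)| ≤ O(1)e^{−δ₁|y−y′|}  (2.79)  for y, y′ belonging to 𝔅∩□ rescaled to
  unit scale.»  ([3] = [B4]; Sect. 5 Theorem p. 594, (5.6) ⟹ (5.7), kernel-checked for every `Ω ⊆ ℤ^d` in the tree node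
  `B4Sect5Exhaustion`.)
* [B9] p. 395: «This implies positivity of the operators G′, Q′G′²Q′*, hence the existence of the operator R.»

**What the tree already has (imported, untouched).**  `B6QGQLower276`: the site matrix `A = Δ^η + aQ*Q` on the
`η = (n+1)⁻¹`-lattice `ℤ^d` (`Aker n a`), its B4 Sect. 5 inverse kernel `G' = limInv ℤ^d A`, the block kernel
`kerQGQ n a y y' = (n+1)^{−d} Σ_{p∈B(y)} Σ_{q∈B(y')} G'(p,q)` of `Q'G'Q'*` and the Fourier-free lower bound (2.76)
`qGq_lower` (constant `gammaQ d a = 1/(36^d(4d+a))`); `B6QGQDecay237`: the mesh-free `ℓ²` set-to-set bound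
`gPrime_setDecay` for `G'` (constant `2/min(2,a)`, rate `deltaU`) and HONEST SCOPE (ii) there: «First power: the printed
sentence of [B6] p. 237 concerns Q'G'^ξ(□̃)²Q'* (square of G', restricted to a cube □̃); this file treats Q'G'Q'*»;
`B5Hk103ScalarZd`: `Gk`, `gq = (G'Q'*)(p,y) = Σ_{q∈B(y)} G'(p,q)`, the block bound `abs_sum_mul_gq_le`, block-by-block
summation `tsum_blocks`; the TORUS square `Q′_kG′_k²Q′_k^*` of [B5] p. 25–26 is treated by circulant Fourier analysis in
`B5QGGQ145Torus`/`B5QGGQ145Bounds` (other lineage; finite torus, not `ℤ^d`).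

**This file (unit b2b-balaban-pv23-g10, SURGE NODE PROVER #23 gen 10, self-row B6-QGGQ-278-ZD)** treats the SQUARE
on the WHOLE LATTICE `ℤ^d` (print's `□̃` replaced by the whole lattice, `ξ`/background field absent: scalar case),
Fourier-free, along print's own route (2.72)–(2.73)–(2.78) and the Sect.-5 sentence of p. 237 — all sorry-free:
1. §1 [folklore] `GT` = `G'` applied to a function supported on a finite site set `T`; **`sum_GT_sq_le`** /
   `tsum_GT_sq_le`: `Σ'_p |(G'g)(p)|² ≤ (2/min(2,a))² Σ_T g²` — `G'` is `ℓ²(sites)`-bounded with a MESH-FREE constant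
   (duality on `gPrime_setDecay` at distance `0`, then exhaustion).
2. §2 [folklore] `gqT` = `G'Q'*B` for a coarse `B` supported on a finite `T ⊆ ℤ^d` (`Q'*B = B∘blk`); `gqT_eq_GT`,
   `sum_blocks_comp_sq` (`‖Q'*B‖²_{sites} = (n+1)^d Σ_T B²`), `tsum_gqT_sq_le`.
3. §3 the square form **`sqForm n a T B = (n+1)^{−d} Σ'_p |(G'Q'*B)(p)|²`** = print's `⟨ω, Q′G′²Q′*ω⟩ = ‖G′Q′*ω‖²`
   (2.72) in site coordinates (the factor `(n+1)^{−d} = η^d` is the `η`-lattice volume element); **`sqForm_le`** (the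
   «bound from above», constant `(2/min(2,a))²`) and **`sqForm_ge`**: `γ_Q² Σ_T B² ≤ sqForm` — print's (2.78) with
   `γ₀ ↦ gammaQ d a`, proved by print's mechanism: (2.76)/(2.77) (`qGq_lower`) and the Cauchy–Schwarz step of (2.73)
   between `Q'*B` and `G'Q'*B` (`qGq_sum_eq`: `⟨B, Q'G'Q'*B⟩ = (n+1)^{−d}⟨Q'*B, G'Q'*B⟩_{sites}`).  MESH-FREE both ways.
4. §4 the kernel **`kerSq n a y y' = (n+1)^{−d} Σ'_r (G'Q'*)(r,y)(G'Q'*)(r,y')`** of `Q'G'²Q'*` (= `⟨G'Q'*δ_y, G'Q'*δ_{y'}⟩`,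
   the convention of the torus sibling `B5QGGQ145Torus.qggq`): absolutely convergent, symmetric (`kerSq_symm`),
   `sqForm = Σ_{y,y'} B(y) kerSq(y,y') B(y')` (`sqForm_eq_sum_kerSq`), coercive on finitely supported vectors
   (`sq_lower`, `finCoercive_KerSq`, constant `γ_Q²`).
5. §5 the «exponential decay of the kernel»: **`abs_kerSq_le`**: `|kerSq(y,y')| ≤ c_sq e^{−(δ_u/2)|y−y'|_∞}` with
   `c_sq = c_u²(K_d(δ_u/2) + 1)` MESH-FREE (block decomposition `tsum_blocks`, block norms of `G'Q'*` from
   `abs_sum_mul_gq_le`, triangle split `exp_split_triangle`, lattice sums `tsum_expX_le`).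
6. §6 the Sect.-5 conclusion: **`hyp56Z_KerSq`** — `Q'G'²Q'*` satisfies B4 (5.6) on the whole unit lattice with
   mesh-free `(γ_Q², c_sq, δ_u/2)`; hence the inverse kernel **`Csq = limInv ℤ^d (Q'G'²Q'*)`** («the operator C»)
   satisfies **`abs_Csq_le`**: `|C(y,y')| ≤ c⋆ e^{−δ⋆|y−y'|_∞}` (`B4Sect5Exhaustion.limInv_abs_le`; the (2.79) shadow, `c⋆`,
   `δ⋆` = `cStar`/`deltaStar` of the mesh-free data, depending on `d, a` only) and **`tsum_Csq_mul_kerSq`**: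
   `Σ'_{y'} C(y,y')(Q'G'²Q'*)(y',z) = δ_{yz}` («the existence of the operator», [B9] p. 395, scalar whole-lattice
   shadow); `sq_operator_window` packages items 3–6.

**HONEST SCOPE.**  (i) Scalar case only (`U = 1`, no `ξ`, no background field): print's `G′^ξ(□̃)` is the covariant
propagator restricted to a large cube `□̃`; here `G'` is the scalar whole-lattice inverse and `□̃ = ℤ^d` — the
localisation to cubes, the `Q″`/`ω₁` bookkeeping of (2.71)–(2.72) and the term `O(1)e^{−δ₀M}` of (2.74)/(2.77) do not
arise.  (ii) Finitely supported coarse vectors `B` (support `T` finite, arbitrary): the `ℓ²(ℤ^d)` extension is the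
density step `B4Sect5L2.hyp56Z_coercive_of_finCoercive` used in §6, not spelled out for `sqForm` itself.  (iii) Norms
are `ℓ²(counting measure)` on sites with the explicit volume factor `(n+1)^{−d}`; constants are ours (`gammaQ²`,
`(2/min(2,a))²`, `cSq`, `deltaU/2`, `cStar`, `deltaStar`), not print's `γ₀², O(1), δ₀, δ₁`; print's `γ₀` is absolute for
`a = 1`, ours depend on `d` and `a`.  (iv) The alternative proof of (2.79) named on p. 237 (conjugation by `e^{⟨a,·⟩}`) is
not followed; the Sect.-5 route is.  (v) Torus versions: see `B5QGGQ145Torus`/`B5QGGQ145Bounds`; no torus↔`ℤ^d`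
comparison is made here.  NOT summit progress: a scalar whole-lattice shadow of one printed paragraph.

**ABSOLUTE-RULE CENSUS.**  Hypothesis-free: every theorem below is proved from Mathlib and kernel-checked tree modules
(`B6QGQLower276`, `B6QGQDecay237`, `B5Hk103ScalarZd`, `B5Hk103Unique`, `B5HkUniformL2Zd`, `B4Sect5Exhaustion`,
`B4Sect5L2`, `B4Sect5Proof`); no statement of the papers under audit is used as a hypothesis; no `def … : Prop`.
Tags: `[cite: Balaban1984PropagatorsII, …]` on the items that discharge the scalar whole-lattice content of the quoted
sentences, `[folklore]` for `ℓ²`/lattice bookkeeping.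
-/

namespace Literature.MathematicalPhysics.QuantumFieldTheory.Balaban1983to89.B6QGGQ278Zd

open Filter Topology
open B4Sect5Exhaustion B4Sect5L2 B6QGQLower276 B6QGQDecay237
open B4Sect5Proof (cStar deltaStar cStar_pos deltaStar_pos latticeConst latticeConst_nonneg)
open B5Hk103ScalarZd (Gk gq toK abs_sum_mul_gq_le summable_expX tsum_expX_le tsum_blocks summable_blocks
  exp_split_triangle)
open B5Hk103Unique (summable_mul_of_sq)
open B5HkUniformL2Zd (sum_mul_le_sqrt_mul_sqrt)

noncomputable section

variable {d : ℕ}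

/-! ## §1  `G'` is `ℓ²(sites)`-bounded, mesh-free [folklore] -/

/-- From `γY ≤ C·√Y·√Z` (`γ, Y, Z ≥ 0`) to `γ²Y ≤ C²Z`. [folklore] -/
theorem sq_le_of_le_sqrt_mul_sqrt {γ C Y Z : ℝ} (hγ : 0 ≤ γ) (hY : 0 ≤ Y) (hZ : 0 ≤ Z)
    (h : γ * Y ≤ C * Real.sqrt Y * Real.sqrt Z) : γ ^ 2 * Y ≤ C ^ 2 * Z := by
  by_cases hy : Real.sqrt Y = 0
  · rw [(Real.sqrt_eq_zero hY).1 hy, mul_zero]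
    exact mul_nonneg (sq_nonneg _) hZ
  · have hpos : 0 < Real.sqrt Y := lt_of_le_of_ne (Real.sqrt_nonneg Y) (Ne.symm hy)
    have h2 : (γ * Real.sqrt Y) * Real.sqrt Y ≤ (C * Real.sqrt Z) * Real.sqrt Y := by
      calc (γ * Real.sqrt Y) * Real.sqrt Y = γ * Y := by rw [mul_assoc, Real.mul_self_sqrt hY]
        _ ≤ C * Real.sqrt Y * Real.sqrt Z := h
        _ = (C * Real.sqrt Z) * Real.sqrt Y := by ring
    have h1 : γ * Real.sqrt Y ≤ C * Real.sqrt Z := le_of_mul_le_mul_right h2 hpos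
    have h3 : 0 ≤ γ * Real.sqrt Y := mul_nonneg hγ (Real.sqrt_nonneg Y)
    calc γ ^ 2 * Y = (γ * Real.sqrt Y) ^ 2 := by rw [mul_pow, Real.sq_sqrt hY]
      _ ≤ (C * Real.sqrt Z) ^ 2 := pow_le_pow_left₀ h3 h1 2
      _ = C ^ 2 * Z := by rw [mul_pow, Real.sq_sqrt hZ]

/-- `G'` applied to a function supported on the finite site set `T`: `(G'g)(p) = Σ_{q∈T} G'(p,q) g(q)`. [folklore] -/
def GT (n : ℕ) (a : ℝ) (T : Finset (X d)) (g : X d → ℝ) (p : X d) : ℝ := ∑ q ∈ T, Gk n a p q * g q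

/-- **`G'` is `ℓ²`-bounded with the mesh-free constant `2/min(2,a)`**, on every finite window `S`:
`Σ_{p∈S} |(G'g)(p)|² ≤ (2/min(2,a))² Σ_{q∈T} g(q)²` (duality on `B6QGQDecay237.gPrime_setDecay` at distance `0`).
[folklore] -/
theorem sum_GT_sq_le (n : ℕ) {a : ℝ} (ha : 0 < a) (T S : Finset (X d)) (g : X d → ℝ) :
    ∑ p ∈ S, GT n a T g p ^ 2 ≤ (2 / min 2 a) ^ 2 * ∑ q ∈ T, g q ^ 2 := by
  have h := gPrime_setDecay n ha Set.univ S T (Set.subset_univ _) (Set.subset_univ _) 0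
    (fun p _ q _ => dist_nonneg) (GT n a T g) g
  have hexp : Real.exp (-(deltaU d a * (0 / ((n : ℝ) + 1)))) = 1 := by
    rw [zero_div, mul_zero, neg_zero, Real.exp_zero]
  have hsum : ∑ p ∈ S, ∑ q ∈ T, GT n a T g p * limInv Set.univ (Aker n a) (p, 0) (q, 0) * g q
      = ∑ p ∈ S, GT n a T g p ^ 2 := by
    refine Finset.sum_congr rfl fun p _ => ?_
    simp_rw [mul_assoc]
    rw [← Finset.mul_sum, sq]
    rfl
  rw [hexp, mul_one, hsum] at h
  have h' : 1 * ∑ p ∈ S, GT n a T g p ^ 2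
      ≤ 2 / min 2 a * Real.sqrt (∑ p ∈ S, GT n a T g p ^ 2) * Real.sqrt (∑ q ∈ T, g q ^ 2) := by
    rw [one_mul]; exact (le_abs_self _).trans h
  have h2 := sq_le_of_le_sqrt_mul_sqrt zero_le_one (Finset.sum_nonneg fun _ _ => sq_nonneg _)
    (Finset.sum_nonneg fun _ _ => sq_nonneg _) h'
  simpa only [one_pow, one_mul] using h2

/-- `p ↦ |(G'g)(p)|²` is summable over the whole lattice (finitely supported `g`). [folklore] -/
theorem summable_GT_sq (n : ℕ) {a : ℝ} (ha : 0 < a) (T : Finset (X d)) (g : X d → ℝ) :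
    Summable fun p : X d => GT n a T g p ^ 2 :=
  summable_of_sum_le (fun _ => sq_nonneg _) fun S => sum_GT_sq_le n ha T S g

/-- **`‖G'g‖²_{ℓ²(ℤ^d)} ≤ (2/min(2,a))² ‖g‖²`** for finitely supported `g`. [folklore] -/
theorem tsum_GT_sq_le (n : ℕ) {a : ℝ} (ha : 0 < a) (T : Finset (X d)) (g : X d → ℝ) :
    ∑' p : X d, GT n a T g p ^ 2 ≤ (2 / min 2 a) ^ 2 * ∑ q ∈ T, g q ^ 2 :=
  (summable_GT_sq n ha T g).tsum_le_of_sum_le fun S => sum_GT_sq_le n ha T S g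

/-! ## §2  `G'Q'*` on finitely supported coarse vectors [folklore] -/

/-- The fine-lattice support of a coarse set `T`: the union of the blocks `B(y)`, `y ∈ T`. [folklore] -/
def blocks (n : ℕ) (T : Finset (X d)) : Finset (X d) := T.biUnion (B n)

/-- Distinct blocks are disjoint. [folklore] -/
theorem pairwiseDisjoint_B (n : ℕ) (T : Finset (X d)) : (↑T : Set (X d)).PairwiseDisjoint (B n) :=
  fun _ _ _ _ hne => B_disjoint hne

/-- `G'Q'*` applied to a coarse vector `B` supported on the finite set `T`:
`(G'Q'*B)(p) = Σ_{y∈T} (G'Q'*)(p,y) B(y)`. [folklore] -/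
def gqT (n : ℕ) (a : ℝ) (T : Finset (X d)) (Bf : X d → ℝ) (p : X d) : ℝ := ∑ y ∈ T, gq n a p y * Bf y

/-- `G'Q'*B = G'(B∘blk)` with `B∘blk` supported on the blocks over `T`. [folklore] -/
theorem gqT_eq_GT (n : ℕ) (a : ℝ) (T : Finset (X d)) (Bf : X d → ℝ) (p : X d) :
    gqT n a T Bf p = GT n a (blocks n T) (fun q => Bf (blk n q)) p := by
  unfold gqT GT blocks
  rw [Finset.sum_biUnion (pairwiseDisjoint_B n T)]
  refine Finset.sum_congr rfl fun y _ => ?_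
  rw [gq, Finset.sum_mul]
  refine Finset.sum_congr rfl fun q hq => ?_
  beta_reduce
  rw [mem_B.1 hq]

/-- `‖Q'*B‖²_{sites} = (n+1)^d ‖B‖²`: each block has `(n+1)^d` sites. [folklore] -/
theorem sum_blocks_comp_sq (n : ℕ) (T : Finset (X d)) (Bf : X d → ℝ) :
    ∑ q ∈ blocks n T, Bf (blk n q) ^ 2 = ((n : ℝ) + 1) ^ d * ∑ y ∈ T, Bf y ^ 2 := by
  unfold blocks
  rw [Finset.sum_biUnion (pairwiseDisjoint_B n T), Finset.mul_sum]
  refine Finset.sum_congr rfl fun y _ => ?_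
  have h : ∑ q ∈ B n y, Bf (blk n q) ^ 2 = ∑ q ∈ B n y, Bf y ^ 2 :=
    Finset.sum_congr rfl fun q hq => by rw [mem_B.1 hq]
  rw [h, sum_B_const]

/-- `p ↦ |(G'Q'*B)(p)|²` is summable over `ℤ^d`. [folklore] -/
theorem summable_gqT_sq (n : ℕ) {a : ℝ} (ha : 0 < a) (T : Finset (X d)) (Bf : X d → ℝ) :
    Summable fun p : X d => gqT n a T Bf p ^ 2 := by
  simp_rw [gqT_eq_GT]
  exact summable_GT_sq n ha _ _

/-- `‖G'Q'*B‖² ≤ (2/min(2,a))² (n+1)^d ‖B‖²`. [folklore] -/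
theorem tsum_gqT_sq_le (n : ℕ) {a : ℝ} (ha : 0 < a) (T : Finset (X d)) (Bf : X d → ℝ) :
    ∑' p : X d, gqT n a T Bf p ^ 2 ≤ (2 / min 2 a) ^ 2 * (((n : ℝ) + 1) ^ d * ∑ y ∈ T, Bf y ^ 2) := by
  simp_rw [gqT_eq_GT]
  rw [← sum_blocks_comp_sq]
  exact tsum_GT_sq_le n ha _ _

/-! ## §3  The form of `Q'G'²Q'*` (2.72) and its mesh-free window: upper bound and (2.78) -/

/-- **(2.72), scalar whole-lattice shadow: `⟨B, Q'G'²Q'*B⟩ = ‖G'Q'*B‖²_η = (n+1)^{−d} Σ'_p |(G'Q'*B)(p)|²`** for a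
coarse `B` supported on the finite set `T` (the factor `(n+1)^{−d} = η^d` is the volume element of the `η`-lattice).
[cite: Balaban1984PropagatorsII, (2.72) p.236] -/
def sqForm (n : ℕ) (a : ℝ) (T : Finset (X d)) (Bf : X d → ℝ) : ℝ :=
  (((n : ℝ) + 1) ^ d)⁻¹ * ∑' p : X d, gqT n a T Bf p ^ 2

/-- `⟨B, Q'G'²Q'*B⟩ ≥ 0` («This operator is of course nonnegative»). [folklore] -/
theorem sqForm_nonneg (n : ℕ) (a : ℝ) (T : Finset (X d)) (Bf : X d → ℝ) : 0 ≤ sqForm n a T Bf :=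
  mul_nonneg (inv_nonneg.2 (by positivity)) (tsum_nonneg fun _ => sq_nonneg _)

/-- **The «bound from above», mesh-free: `⟨B, Q'G'²Q'*B⟩ ≤ (2/min(2,a))² ‖B‖²`.**
[cite: Balaban1984PropagatorsII, p.237] -/
theorem sqForm_le (n : ℕ) {a : ℝ} (ha : 0 < a) (T : Finset (X d)) (Bf : X d → ℝ) :
    sqForm n a T Bf ≤ (2 / min 2 a) ^ 2 * ∑ y ∈ T, Bf y ^ 2 := by
  have hN : (0 : ℝ) < ((n : ℝ) + 1) ^ d := by positivity
  unfold sqForm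
  calc (((n : ℝ) + 1) ^ d)⁻¹ * ∑' p : X d, gqT n a T Bf p ^ 2
      ≤ (((n : ℝ) + 1) ^ d)⁻¹ * ((2 / min 2 a) ^ 2 * (((n : ℝ) + 1) ^ d * ∑ y ∈ T, Bf y ^ 2)) :=
        mul_le_mul_of_nonneg_left (tsum_gqT_sq_le n ha T Bf) (inv_nonneg.2 hN.le)
    _ = (2 / min 2 a) ^ 2 * ∑ y ∈ T, Bf y ^ 2 := by
        rw [mul_left_comm ((2 / min 2 a) ^ 2), inv_mul_cancel_left₀ hN.ne', ]

/-- **The identity behind (2.73): `⟨B, Q'G'Q'*B⟩ = (n+1)^{−d} ⟨Q'*B, G'Q'*B⟩_{sites}`** (finitely supported `B`).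
[cite: Balaban1984PropagatorsII, (2.73) p.236] -/
theorem qGq_sum_eq (n : ℕ) (a : ℝ) (T : Finset (X d)) (Bf : X d → ℝ) :
    ∑ y ∈ T, Bf y * ∑ y' ∈ T, kerQGQ n a y y' * Bf y'
      = (((n : ℝ) + 1) ^ d)⁻¹ * ∑ p ∈ blocks n T, Bf (blk n p) * gqT n a T Bf p := by
  have h1 : ∀ y : X d, ∑ y' ∈ T, kerQGQ n a y y' * Bf y'
      = (((n : ℝ) + 1) ^ d)⁻¹ * ∑ p ∈ B n y, gqT n a T Bf p := by
    intro y
    symm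
    calc (((n : ℝ) + 1) ^ d)⁻¹ * ∑ p ∈ B n y, gqT n a T Bf p
        = (((n : ℝ) + 1) ^ d)⁻¹ * ∑ y' ∈ T, ∑ p ∈ B n y, gq n a p y' * Bf y' := by
          unfold gqT; rw [Finset.sum_comm]
      _ = ∑ y' ∈ T, ((((n : ℝ) + 1) ^ d)⁻¹ * ∑ p ∈ B n y, gq n a p y') * Bf y' := by
          rw [Finset.mul_sum]
          refine Finset.sum_congr rfl fun y' _ => ?_
          rw [← Finset.sum_mul, mul_assoc]
      _ = ∑ y' ∈ T, kerQGQ n a y y' * Bf y' := rfl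
  unfold blocks
  rw [Finset.sum_biUnion (pairwiseDisjoint_B n T), Finset.mul_sum]
  refine Finset.sum_congr rfl fun y _ => ?_
  have h2 : ∑ p ∈ B n y, Bf (blk n p) * gqT n a T Bf p = Bf y * ∑ p ∈ B n y, gqT n a T Bf p := by
    rw [Finset.mul_sum]
    exact Finset.sum_congr rfl fun p hp => by rw [mem_B.1 hp]
  rw [h2, h1 y]
  ring

/-- **(2.78), scalar whole-lattice shadow, MESH-FREE: `γ_Q² ‖B‖² ≤ ⟨B, Q'G'²Q'*B⟩`** with `γ_Q = gammaQ d a` the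
constant of (2.76) (`B6QGQLower276.qGq_lower`).  Print's mechanism: (2.76)/(2.77) `γ_Q‖B‖² ≤ ⟨B, Q'G'Q'*B⟩`, then
(2.73) `⟨B, Q'G'Q'*B⟩ = (n+1)^{−d}⟨Q'*B, G'Q'*B⟩ ≤ (n+1)^{−d}‖Q'*B‖‖G'Q'*B‖ = (n+1)^{−d/2}‖B‖·‖G'Q'*B‖`, and square.
[cite: Balaban1984PropagatorsII, (2.78) p.236] -/
theorem sqForm_ge (n : ℕ) {a : ℝ} (ha : 0 < a) (T : Finset (X d)) (Bf : X d → ℝ) :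
    gammaQ d a ^ 2 * ∑ y ∈ T, Bf y ^ 2 ≤ sqForm n a T Bf := by
  have hN : (0 : ℝ) < ((n : ℝ) + 1) ^ d := by positivity
  have hY0 : 0 ≤ ∑ y ∈ T, Bf y ^ 2 := Finset.sum_nonneg fun _ _ => sq_nonneg _
  have hZ := summable_gqT_sq n ha T Bf
  -- (2.76)/(2.77)
  have h1 : gammaQ d a * ∑ y ∈ T, Bf y ^ 2 ≤ ∑ y ∈ T, Bf y * ∑ y' ∈ T, kerQGQ n a y y' * Bf y' :=
    qGq_lower n ha T Bf
  rw [qGq_sum_eq] at h1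
  -- (2.73): Cauchy–Schwarz between `Q'*B` and `G'Q'*B` on the blocks over `T`
  have h2 : ∑ p ∈ blocks n T, Bf (blk n p) * gqT n a T Bf p
      ≤ Real.sqrt (∑ p ∈ blocks n T, Bf (blk n p) ^ 2) * Real.sqrt (∑ p ∈ blocks n T, gqT n a T Bf p ^ 2) :=
    sum_mul_le_sqrt_mul_sqrt _ _ _
  have h3 : ∑ p ∈ blocks n T, gqT n a T Bf p ^ 2 ≤ ∑' p : X d, gqT n a T Bf p ^ 2 :=
    hZ.sum_le_tsum _ fun _ _ => sq_nonneg _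
  rw [sum_blocks_comp_sq] at h2
  have h4 : gammaQ d a * ∑ y ∈ T, Bf y ^ 2
      ≤ ((((n : ℝ) + 1) ^ d)⁻¹ * Real.sqrt (((n : ℝ) + 1) ^ d)) * Real.sqrt (∑ y ∈ T, Bf y ^ 2)
          * Real.sqrt (∑' p : X d, gqT n a T Bf p ^ 2) := by
    calc gammaQ d a * ∑ y ∈ T, Bf y ^ 2
        ≤ (((n : ℝ) + 1) ^ d)⁻¹ * ∑ p ∈ blocks n T, Bf (blk n p) * gqT n a T Bf p := h1
      _ ≤ (((n : ℝ) + 1) ^ d)⁻¹ * (Real.sqrt (((n : ℝ) + 1) ^ d * ∑ y ∈ T, Bf y ^ 2)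
            * Real.sqrt (∑ p ∈ blocks n T, gqT n a T Bf p ^ 2)) :=
          mul_le_mul_of_nonneg_left h2 (inv_nonneg.2 hN.le)
      _ ≤ (((n : ℝ) + 1) ^ d)⁻¹ * (Real.sqrt (((n : ℝ) + 1) ^ d * ∑ y ∈ T, Bf y ^ 2)
            * Real.sqrt (∑' p : X d, gqT n a T Bf p ^ 2)) := by
          gcongr
      _ = ((((n : ℝ) + 1) ^ d)⁻¹ * Real.sqrt (((n : ℝ) + 1) ^ d)) * Real.sqrt (∑ y ∈ T, Bf y ^ 2)
          * Real.sqrt (∑' p : X d, gqT n a T Bf p ^ 2) := by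
          rw [Real.sqrt_mul hN.le]; ring
  have h5 := sq_le_of_le_sqrt_mul_sqrt (gammaQ_pos d ha).le hY0 (tsum_nonneg fun _ => sq_nonneg _) h4
  have h6 : ((((n : ℝ) + 1) ^ d)⁻¹ * Real.sqrt (((n : ℝ) + 1) ^ d)) ^ 2 = (((n : ℝ) + 1) ^ d)⁻¹ := by
    rw [mul_pow, Real.sq_sqrt hN.le, pow_two, mul_assoc, inv_mul_cancel₀ hN.ne', mul_one]
  rw [h6] at h5
  exact h5

/-! ## §4  The kernel of `Q'G'²Q'*`, symmetry, the form as a double sum, coercivity on finite supports -/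

/-- **The kernel of `Q'G'²Q'*` on the unit lattice `ℤ^d`** (scalar case): `(Q'G'²Q'*)(y,y') =
⟨G'Q'*δ_y, G'Q'*δ_{y'}⟩_η = (n+1)^{−d} Σ'_r (G'Q'*)(r,y)(G'Q'*)(r,y')` — absolutely convergent (`summable_gq_mul_gq`).
[cite: Balaban1984PropagatorsII, (2.72) p.236, p.237] -/
def kerSq (n : ℕ) (a : ℝ) (y y' : X d) : ℝ :=
  (((n : ℝ) + 1) ^ d)⁻¹ * ∑' r : X d, gq n a r y * gq n a r y'

/-- A column of `G'Q'*` is `G'Q'*` of a coarse delta. [folklore] -/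
theorem gq_eq_gqT_single (n : ℕ) (a : ℝ) (r y : X d) : gq n a r y = gqT n a {y} (fun _ => 1) r := by
  simp [gqT]

/-- Columns of `G'Q'*` are square-summable over `ℤ^d`. [folklore] -/
theorem summable_gq_sq (n : ℕ) {a : ℝ} (ha : 0 < a) (y : X d) : Summable fun r : X d => gq n a r y ^ 2 := by
  simp_rw [gq_eq_gqT_single]
  exact summable_gqT_sq n ha _ _

/-- `‖(G'Q'*)(·,y)‖² ≤ (2/min(2,a))² (n+1)^d`. [folklore] -/
theorem tsum_gq_sq_le (n : ℕ) {a : ℝ} (ha : 0 < a) (y : X d) :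
    ∑' r : X d, gq n a r y ^ 2 ≤ (2 / min 2 a) ^ 2 * ((n : ℝ) + 1) ^ d := by
  have h := tsum_gqT_sq_le n ha {y} (fun _ => (1 : ℝ))
  simp only [Finset.sum_singleton, one_pow, mul_one] at h
  simp_rw [gq_eq_gqT_single]
  exact h

/-- The terms of the kernel series are absolutely summable. [folklore] -/
theorem summable_gq_mul_gq (n : ℕ) {a : ℝ} (ha : 0 < a) (y y' : X d) :
    Summable fun r : X d => gq n a r y * gq n a r y' :=
  summable_mul_of_sq (summable_gq_sq n ha y) (summable_gq_sq n ha y')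

/-- **`Q'G'²Q'*` is symmetric.** [folklore] -/
theorem kerSq_symm (n : ℕ) (a : ℝ) (y y' : X d) : kerSq n a y y' = kerSq n a y' y := by
  unfold kerSq
  congr 1
  exact tsum_congr fun r => mul_comm _ _

/-- **The form is the double sum against the kernel**: `⟨B, Q'G'²Q'*B⟩ = Σ_{y,y'∈T} B(y)(Q'G'²Q'*)(y,y')B(y')`.
[folklore] -/
theorem sqForm_eq_sum_kerSq (n : ℕ) {a : ℝ} (ha : 0 < a) (T : Finset (X d)) (Bf : X d → ℝ) :
    sqForm n a T Bf = ∑ y ∈ T, Bf y * ∑ y' ∈ T, kerSq n a y y' * Bf y' := by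
  have hs : ∀ y y' : X d, Summable fun r : X d => gq n a r y * gq n a r y' :=
    fun y y' => summable_gq_mul_gq n ha y y'
  have e1 : ∀ p : X d, gqT n a T Bf p ^ 2
      = ∑ y ∈ T, ∑ y' ∈ T, (Bf y * Bf y') * (gq n a p y * gq n a p y') := by
    intro p
    rw [sq, gqT, Finset.sum_mul_sum]
    refine Finset.sum_congr rfl fun y _ => Finset.sum_congr rfl fun y' _ => by ring
  have e2 : ∑' p : X d, gqT n a T Bf p ^ 2
      = ∑ y ∈ T, ∑ y' ∈ T, (Bf y * Bf y') * ∑' p : X d, gq n a p y * gq n a p y' := by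
    simp_rw [e1]
    rw [Summable.tsum_finsetSum (fun y _ => summable_sum fun y' _ => (hs y y').mul_left _)]
    refine Finset.sum_congr rfl fun y _ => ?_
    rw [Summable.tsum_finsetSum (fun y' _ => (hs y y').mul_left _)]
    refine Finset.sum_congr rfl fun y' _ => ?_
    exact tsum_mul_left
  unfold sqForm
  rw [e2, Finset.mul_sum]
  refine Finset.sum_congr rfl fun y _ => ?_
  rw [Finset.mul_sum, Finset.mul_sum]
  refine Finset.sum_congr rfl fun y' _ => ?_
  unfold kerSq
  ring

/-- **Coercivity of `Q'G'²Q'*` on finitely supported vectors**, kernel form: `γ_Q² Σ_S c² ≤ Σ_{y,y'∈S} c(y)(Q'G'²Q'*)(y,y')c(y')`.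
[cite: Balaban1984PropagatorsII, (2.78) p.236] -/
theorem sq_lower (n : ℕ) {a : ℝ} (ha : 0 < a) (S : Finset (X d)) (c : X d → ℝ) :
    gammaQ d a ^ 2 * ∑ y ∈ S, c y ^ 2 ≤ ∑ y ∈ S, c y * ∑ y' ∈ S, kerSq n a y y' * c y' := by
  rw [← sqForm_eq_sum_kerSq n ha]
  exact sqForm_ge n ha S c

/-- The kernel of `Q'G'²Q'*` on B4's scalar index set `ℤ^d × Fin 1`. [folklore] -/
def KerSq (n : ℕ) (a : ℝ) : K d 1 → K d 1 → ℝ := fun y y' => kerSq n a y.1 y'.1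

/-- `Q'G'²Q'*` is `FinCoercive` (B4Sect5L2) with constant `γ_Q²`. [cite: Balaban1984PropagatorsII, (2.78) p.236] -/
theorem finCoercive_KerSq (n : ℕ) {a : ℝ} (ha : 0 < a) :
    FinCoercive (kerA (Set.univ : Set (Fin d → ℤ)) (KerSq (d := d) n a)) (gammaQ d a ^ 2) := by
  classical
  intro s c
  have h := sq_lower n ha (s.map embX) (fun x => c (ofX x))
  simp only [Finset.sum_map, embX_apply, ofX_toX] at h
  exact h

/-! ## §5  «an exponential decay of the kernel of `Q'G'²Q'*`», mesh-free -/

/-- Cauchy–Schwarz with absolute value on a finite window. [folklore] -/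
theorem abs_sum_mul_le_sqrt {α : Type*} (S : Finset α) (u v : α → ℝ) :
    |∑ p ∈ S, u p * v p| ≤ Real.sqrt (∑ p ∈ S, u p ^ 2) * Real.sqrt (∑ p ∈ S, v p ^ 2) := by
  refine abs_le.2 ⟨?_, sum_mul_le_sqrt_mul_sqrt S u v⟩
  have h := sum_mul_le_sqrt_mul_sqrt S (fun p => -u p) v
  beta_reduce at h
  have e1 : ∑ p ∈ S, -u p * v p = -∑ p ∈ S, u p * v p := by
    rw [← Finset.sum_neg_distrib]
    exact Finset.sum_congr rfl fun _ _ => by ring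
  have e2 : ∑ p ∈ S, (-u p) ^ 2 = ∑ p ∈ S, u p ^ 2 :=
    Finset.sum_congr rfl fun _ _ => by ring
  rw [e1, e2] at h
  linarith

/-- **Block norms of the columns of `G'Q'*` decay**: `‖(G'Q'*)(·,y)‖_{ℓ²(B(z))} ≤ c_u (n+1)^{d/2} e^{−δ_u|z−y|_∞}`
(duality on `B5Hk103ScalarZd.abs_sum_mul_gq_le`). [folklore] -/
theorem sqrt_sum_gq_sq_le (n : ℕ) {a : ℝ} (ha : 0 < a) (z y : X d) :
    Real.sqrt (∑ r ∈ B n z, gq n a r y ^ 2)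
      ≤ cU d a * Real.sqrt (((n : ℝ) + 1) ^ d) * Real.exp (-(deltaU d a * dist z y)) := by
  have h := abs_sum_mul_gq_le n ha z y (fun r => gq n a r y)
  have hW0 : 0 ≤ Real.sqrt (∑ r ∈ B n z, gq n a r y ^ 2) := Real.sqrt_nonneg _
  have hsum : ∑ p ∈ B n z, (fun r => gq n a r y) p * gq n a p y
      = Real.sqrt (∑ r ∈ B n z, gq n a r y ^ 2) * Real.sqrt (∑ r ∈ B n z, gq n a r y ^ 2) := by
    rw [Real.mul_self_sqrt (Finset.sum_nonneg fun _ _ => sq_nonneg _)]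
    exact Finset.sum_congr rfl fun _ _ => by ring
  have hsq : ∑ p ∈ B n z, (fun r => gq n a r y) p ^ 2 = ∑ r ∈ B n z, gq n a r y ^ 2 := rfl
  rw [hsum, hsq] at h
  have hM0 : 0 ≤ cU d a * Real.sqrt (((n : ℝ) + 1) ^ d) * Real.exp (-(deltaU d a * dist z y)) := by
    have := cU_pos d ha
    positivity
  by_cases hw : Real.sqrt (∑ r ∈ B n z, gq n a r y ^ 2) = 0
  · rw [hw]; exact hM0
  · have hWpos : 0 < Real.sqrt (∑ r ∈ B n z, gq n a r y ^ 2) := lt_of_le_of_ne hW0 (Ne.symm hw)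
    have h' : Real.sqrt (∑ r ∈ B n z, gq n a r y ^ 2) * Real.sqrt (∑ r ∈ B n z, gq n a r y ^ 2)
        ≤ (cU d a * Real.sqrt (((n : ℝ) + 1) ^ d) * Real.exp (-(deltaU d a * dist z y)))
          * Real.sqrt (∑ r ∈ B n z, gq n a r y ^ 2) := by
      calc Real.sqrt (∑ r ∈ B n z, gq n a r y ^ 2) * Real.sqrt (∑ r ∈ B n z, gq n a r y ^ 2)
          ≤ |Real.sqrt (∑ r ∈ B n z, gq n a r y ^ 2) * Real.sqrt (∑ r ∈ B n z, gq n a r y ^ 2)| :=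
            le_abs_self _
        _ ≤ cU d a * Real.exp (-(deltaU d a * dist z y))
            * Real.sqrt (∑ r ∈ B n z, gq n a r y ^ 2) * Real.sqrt (((n : ℝ) + 1) ^ d) := h
        _ = (cU d a * Real.sqrt (((n : ℝ) + 1) ^ d) * Real.exp (-(deltaU d a * dist z y)))
            * Real.sqrt (∑ r ∈ B n z, gq n a r y ^ 2) := by ring
    exact le_of_mul_le_mul_right h' hWpos

/-- **Block pieces of the kernel series decay in both arguments**:
`|Σ_{r∈B(z)} (G'Q'*)(r,y)(G'Q'*)(r,y')| ≤ c_u²(n+1)^d e^{−δ_u|z−y|_∞} e^{−δ_u|z−y'|_∞}`. [folklore] -/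
theorem abs_blockSum_le (n : ℕ) {a : ℝ} (ha : 0 < a) (z y y' : X d) :
    |∑ r ∈ B n z, gq n a r y * gq n a r y'|
      ≤ cU d a ^ 2 * ((n : ℝ) + 1) ^ d
        * (Real.exp (-(deltaU d a * dist z y)) * Real.exp (-(deltaU d a * dist z y'))) := by
  have hN : (0 : ℝ) ≤ ((n : ℝ) + 1) ^ d := by positivity
  have h := abs_sum_mul_le_sqrt (B n z) (fun r => gq n a r y) (fun r => gq n a r y')
  have h1 := sqrt_sum_gq_sq_le n ha z y
  have h2 := sqrt_sum_gq_sq_le n ha z y'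
  have hc : 0 ≤ cU d a * Real.sqrt (((n : ℝ) + 1) ^ d) * Real.exp (-(deltaU d a * dist z y)) := by
    have := cU_pos d ha
    positivity
  have hsq : Real.sqrt (((n : ℝ) + 1) ^ d) * Real.sqrt (((n : ℝ) + 1) ^ d) = ((n : ℝ) + 1) ^ d :=
    Real.mul_self_sqrt hN
  calc |∑ r ∈ B n z, gq n a r y * gq n a r y'|
      ≤ Real.sqrt (∑ r ∈ B n z, gq n a r y ^ 2) * Real.sqrt (∑ r ∈ B n z, gq n a r y' ^ 2) := h
    _ ≤ (cU d a * Real.sqrt (((n : ℝ) + 1) ^ d) * Real.exp (-(deltaU d a * dist z y)))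
        * (cU d a * Real.sqrt (((n : ℝ) + 1) ^ d) * Real.exp (-(deltaU d a * dist z y'))) :=
        mul_le_mul h1 h2 (Real.sqrt_nonneg _) hc
    _ = cU d a ^ 2 * (Real.sqrt (((n : ℝ) + 1) ^ d) * Real.sqrt (((n : ℝ) + 1) ^ d))
        * (Real.exp (-(deltaU d a * dist z y)) * Real.exp (-(deltaU d a * dist z y'))) := by ring
    _ = cU d a ^ 2 * ((n : ℝ) + 1) ^ d
        * (Real.exp (-(deltaU d a * dist z y)) * Real.exp (-(deltaU d a * dist z y'))) := by
        rw [hsq]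

/-- The mesh-free constant of the kernel decay: `c_sq = c_u² (K_d(δ_u/2) + 1)`. [folklore] -/
def cSq (d : ℕ) (a : ℝ) : ℝ := cU d a ^ 2 * (latticeConst d (deltaU d a / 2) + 1)

/-- The mesh-free rate of the kernel decay: `δ_sq = δ_u/2`. [folklore] -/
def deltaSq (d : ℕ) (a : ℝ) : ℝ := deltaU d a / 2

/-- `c_sq > 0`. [folklore] -/
theorem cSq_pos (d : ℕ) {a : ℝ} (ha : 0 < a) : 0 < cSq d a := by
  unfold cSq
  have h1 := cU_pos d ha
  have h2 := latticeConst_nonneg d (half_pos (deltaU_pos d ha)).le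
  positivity

/-- `δ_sq > 0`. [folklore] -/
theorem deltaSq_pos (d : ℕ) {a : ℝ} (ha : 0 < a) : 0 < deltaSq d a := half_pos (deltaU_pos d ha)

/-- **«an exponential decay of the kernel of `Q'G'²Q'*`», scalar whole-lattice shadow, MESH-FREE:**
`|(Q'G'²Q'*)(y,y')| ≤ c_sq e^{−(δ_u/2)|y−y'|_∞}` — block decomposition of the kernel series, block norms of the
columns of `G'Q'*`, triangle split, lattice sum. [cite: Balaban1984PropagatorsII, p.237] -/
theorem abs_kerSq_le (n : ℕ) {a : ℝ} (ha : 0 < a) (y y' : X d) :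
    |kerSq n a y y'| ≤ cSq d a * Real.exp (-(deltaSq d a * dist y y')) := by
  have hN : (0 : ℝ) < ((n : ℝ) + 1) ^ d := by positivity
  have hδ := deltaU_pos d ha
  have hb2 : 0 < deltaU d a / 2 := half_pos hδ
  have hcU := cU_pos d ha
  have hs := summable_gq_mul_gq n ha y y'
  -- the series block by block
  have e1 : ∑' r : X d, gq n a r y * gq n a r y' = ∑' z : X d, ∑ r ∈ B n z, gq n a r y * gq n a r y' :=
    (tsum_blocks n hs).symm
  have hF : Summable fun z : X d => ∑ r ∈ B n z, gq n a r y * gq n a r y' := summable_blocks n hs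
  -- the majorant
  obtain ⟨C0, hC0⟩ : ∃ C0 : ℝ, C0 = cU d a ^ 2 * ((n : ℝ) + 1) ^ d
      * Real.exp (-(deltaU d a / 2 * dist y y')) := ⟨_, rfl⟩
  have hC0nn : 0 ≤ C0 := by rw [hC0]; positivity
  have eF : (fun z : X d => Real.exp (-(deltaU d a / 2 * dist z y')))
      = fun z => Real.exp (-(deltaU d a / 2 * dist y' z)) := funext fun z => by rw [dist_comm]
  have hsE : Summable fun z : X d => Real.exp (-(deltaU d a / 2 * dist z y')) := by
    rw [eF]; exact summable_expX hb2 y'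
  have htE : ∑' z : X d, Real.exp (-(deltaU d a / 2 * dist z y')) ≤ latticeConst d (deltaU d a / 2) := by
    rw [eF]; exact tsum_expX_le hb2 y'
  have hb : ∀ z : X d, |∑ r ∈ B n z, gq n a r y * gq n a r y'|
      ≤ C0 * Real.exp (-(deltaU d a / 2 * dist z y')) := by
    intro z
    refine (abs_blockSum_le n ha z y y').trans ?_
    have ht := exp_split_triangle (D := dist y y') hδ.le hδ.le (dist_nonneg (x := z) (y := y))
      (dist_nonneg (x := z) (y := y'))
      (by rw [dist_comm z y]; exact dist_triangle y z y')
    rw [min_self] at ht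
    rw [hC0, mul_assoc (cU d a ^ 2 * ((n : ℝ) + 1) ^ d)]
    exact mul_le_mul_of_nonneg_left ht (by positivity)
  have hFabs : Summable fun z : X d => |∑ r ∈ B n z, gq n a r y * gq n a r y'| :=
    Summable.of_nonneg_of_le (fun _ => abs_nonneg _) hb (hsE.mul_left C0)
  have h1 : |∑' z : X d, ∑ r ∈ B n z, gq n a r y * gq n a r y'|
      ≤ ∑' z : X d, |∑ r ∈ B n z, gq n a r y * gq n a r y'| := by
    have h := norm_tsum_le_tsum_norm (hFabs.congr fun z => (Real.norm_eq_abs _).symm)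
    simpa only [Real.norm_eq_abs] using h
  have h2 : ∑' z : X d, |∑ r ∈ B n z, gq n a r y * gq n a r y'|
      ≤ ∑' z : X d, C0 * Real.exp (-(deltaU d a / 2 * dist z y')) :=
    Summable.tsum_le_tsum hb hFabs (hsE.mul_left C0)
  have h3 : ∑' z : X d, C0 * Real.exp (-(deltaU d a / 2 * dist z y'))
      ≤ C0 * latticeConst d (deltaU d a / 2) := by
    rw [tsum_mul_left]; exact mul_le_mul_of_nonneg_left htE hC0nn
  have hL := latticeConst_nonneg d hb2.le
  calc |kerSq n a y y'|
      = (((n : ℝ) + 1) ^ d)⁻¹ * |∑' z : X d, ∑ r ∈ B n z, gq n a r y * gq n a r y'| := by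
        rw [kerSq, e1, abs_mul, abs_of_pos (inv_pos.2 hN)]
    _ ≤ (((n : ℝ) + 1) ^ d)⁻¹ * (C0 * latticeConst d (deltaU d a / 2)) :=
        mul_le_mul_of_nonneg_left ((h1.trans h2).trans h3) (inv_nonneg.2 hN.le)
    _ = cU d a ^ 2 * latticeConst d (deltaU d a / 2) * Real.exp (-(deltaU d a / 2 * dist y y')) := by
        rw [hC0]
        rw [show (((n : ℝ) + 1) ^ d)⁻¹ * (cU d a ^ 2 * ((n : ℝ) + 1) ^ d
              * Real.exp (-(deltaU d a / 2 * dist y y')) * latticeConst d (deltaU d a / 2))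
            = cU d a ^ 2 * latticeConst d (deltaU d a / 2) * Real.exp (-(deltaU d a / 2 * dist y y'))
              * ((((n : ℝ) + 1) ^ d)⁻¹ * ((n : ℝ) + 1) ^ d) by ring,
          inv_mul_cancel₀ hN.ne', mul_one]
    _ ≤ cSq d a * Real.exp (-(deltaSq d a * dist y y')) := by
        unfold cSq deltaSq
        refine mul_le_mul_of_nonneg_right ?_ (Real.exp_pos _).le
        refine mul_le_mul_of_nonneg_left (by linarith) (sq_nonneg _)

/-! ## §6  B4 (5.6) for `Q'G'²Q'*` and the inverse `C = (Q'G'²Q'*)⁻¹`: existence and the (2.79) shadow -/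

/-- **`Q'G'²Q'*` satisfies B4's condition (5.6) on the whole unit lattice with MESH-FREE constants**
`(γ_Q², c_sq, δ_u/2)`: symmetric, coercive on every finite `Λ` (density step `B4Sect5L2.hyp56Z_coercive_of_finCoercive`),
exponentially decaying entries. («Hence the operator … is bounded from above and below by absolute constants. We can use
the theory developed in Sect. 5 [3]».) [cite: Balaban1984PropagatorsII, p.237] -/
theorem hyp56Z_KerSq (n : ℕ) {a : ℝ} (ha : 0 < a) :
    Hyp56Z (Set.univ : Set (Fin d → ℤ)) (KerSq (d := d) n a) (gammaQ d a ^ 2) (cSq d a) (deltaSq d a) where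
  symm p q _ _ := kerSq_symm n a p.1 q.1
  coercive Λ hΛ v := hyp56Z_coercive_of_finCoercive (finCoercive_KerSq n ha) Λ hΛ v
  decay p q _ _ := abs_kerSq_le n ha p.1 q.1

/-- **«the operator C»: the B4 Sect. 5 inverse kernel `C = (Q'G'²Q'*)⁻¹` on the whole unit lattice `ℤ^d`** (scalar
case; exhaustion limit `limInv ℤ^d`). [cite: Balaban1984PropagatorsII, (2.79) p.237] -/
def Csq (n : ℕ) (a : ℝ) (y y' : X d) : ℝ := limInv Set.univ (KerSq n a) (y, 0) (y', 0)

/-- The (5.7) constant of `C`, depending on `d, a` only. [folklore] -/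
def cC (d : ℕ) (a : ℝ) : ℝ := cStar d 1 (gammaQ d a ^ 2) (cSq d a) (deltaSq d a)

/-- The (5.7) rate of `C` («a decay rate δ₁ depending on δ₀ and the bound γ₀»), depending on `d, a` only. [folklore] -/
def deltaC (d : ℕ) (a : ℝ) : ℝ := deltaStar d 1 (gammaQ d a ^ 2) (cSq d a) (deltaSq d a)

/-- `cC > 0`. [folklore] -/
theorem cC_pos (d : ℕ) {a : ℝ} (ha : 0 < a) : 0 < cC d a :=
  cStar_pos d 1 (cSq d a) (deltaSq d a) (pow_pos (gammaQ_pos d ha) 2)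

/-- `deltaC > 0`. [folklore] -/
theorem deltaC_pos (d : ℕ) {a : ℝ} (ha : 0 < a) : 0 < deltaC d a :=
  deltaStar_pos d 1 (pow_pos (gammaQ_pos d ha) 2) (cSq_pos d ha).le (deltaSq_pos d ha)

/-- **(2.79), scalar whole-lattice shadow, MESH-FREE: `|C(y,y')| ≤ c⋆ e^{−δ⋆|y−y'|_∞}`** — B4 Sect. 5 Theorem
(`B4Sect5Exhaustion.limInv_abs_le`) fed with `hyp56Z_KerSq`. [cite: Balaban1984PropagatorsII, (2.79) p.237]
[cite: Balaban1983RegularityDecay, (5.7) p.594] -/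
theorem abs_Csq_le (n : ℕ) {a : ℝ} (ha : 0 < a) (y y' : X d) :
    |Csq n a y y'| ≤ cC d a * Real.exp (-(deltaC d a * dist y y')) :=
  limInv_abs_le (pow_pos (gammaQ_pos d ha) 2) (cSq_pos d ha) (deltaSq_pos d ha) (hyp56Z_KerSq n ha) (y, 0) (y', 0)

/-- **«the existence of the operator»: `C·(Q'G'²Q'*) = I` on the unit lattice**, entrywise with the series over the
middle index: `Σ'_{y'} C(y,y')(Q'G'²Q'*)(y',z) = δ_{yz}`. [cite: Balaban1985BackgroundPropagators, p.395]
[cite: Balaban1984PropagatorsII, p.237] -/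
theorem tsum_Csq_mul_kerSq (n : ℕ) {a : ℝ} (ha : 0 < a) (y z : X d) :
    ∑' y' : X d, Csq n a y y' * kerSq n a y' z = if y = z then 1 else 0 := by
  have h2 : ∀ y' : X d, Csq n a y y' * kerSq n a y' z
      = limInv Set.univ (KerSq n a) (toK y) (toK y') * KerSq n a (toK y') (toK z) := fun _ => rfl
  simp_rw [h2]
  rw [Equiv.tsum_eq (toK (d := d)) (fun q' => limInv Set.univ (KerSq n a) (toK y) q' * KerSq n a q' (toK z))]
  rw [tsum_limInv_mul (pow_pos (gammaQ_pos d ha) 2) (cSq_pos d ha) (deltaSq_pos d ha) (hyp56Z_KerSq n ha)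
    (Set.mem_univ _) (Set.mem_univ _)]
  simp [toK, Prod.ext_iff]

/-- **Summary — the scalar whole-lattice content of [B6] p. 236 (2.72)/(2.78) and p. 237 (2.79), MESH-FREE:**
(a) the two-sided window `γ_Q²‖B‖² ≤ ⟨B, Q'G'²Q'*B⟩ ≤ (2/min(2,a))²‖B‖²` on finitely supported coarse vectors;
(b) the kernel decays: `|(Q'G'²Q'*)(y,y')| ≤ c_sq e^{−(δ_u/2)|y−y'|}`; (c) the inverse `C` exists entrywise and decays:
`|C(y,y')| ≤ c⋆e^{−δ⋆|y−y'|}`, `Σ'_{y'} C(y,y')(Q'G'²Q'*)(y',z) = δ_{yz}` — all constants depending on `d, a` only.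
[cite: Balaban1984PropagatorsII, (2.78) p.236, (2.79) p.237] -/
theorem sq_operator_window (n : ℕ) {a : ℝ} (ha : 0 < a) :
    (∀ (T : Finset (X d)) (Bf : X d → ℝ),
        gammaQ d a ^ 2 * ∑ y ∈ T, Bf y ^ 2 ≤ sqForm n a T Bf ∧
          sqForm n a T Bf ≤ (2 / min 2 a) ^ 2 * ∑ y ∈ T, Bf y ^ 2) ∧
      (∀ y y' : X d, |kerSq n a y y'| ≤ cSq d a * Real.exp (-(deltaSq d a * dist y y'))) ∧
      (∀ y y' : X d, |Csq n a y y'| ≤ cC d a * Real.exp (-(deltaC d a * dist y y'))) ∧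
      (∀ y z : X d, ∑' y' : X d, Csq n a y y' * kerSq n a y' z = if y = z then 1 else 0) :=
  ⟨fun T Bf => ⟨sqForm_ge n ha T Bf, sqForm_le n ha T Bf⟩, fun y y' => abs_kerSq_le n ha y y',
    fun y y' => abs_Csq_le n ha y y', fun y z => tsum_Csq_mul_kerSq n ha y z⟩

end

end Literature.MathematicalPhysics.QuantumFieldTheory.Balaban1983to89.B6QGGQ278Zd
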